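import Literature.NumberTheory.Transcendental.TubbsPeriodsIndependenceZeroEst
import HarnessLib

/-!
# Tubbs 1990, Theorem 4 (periods form) — the analytic layer (Schwarz's lemma)

Topic `Literature/NumberTheory/Transcendental` (trunk T-TRANSCEND). Third layer of the proof of the
named fact `Literature.NumberTheory.Transcendental.Tubbs1990_thm4_periods`
(`TubbsPeriodsIndependence.lean`; R. Tubbs, J. Number Theory 35 (1990), Thm 4 p. 112 and §5):
`trdeg_ℚ ℚ(g₂, g₃, ω₁, ω₂, c, e^{cω₁}, e^{cω₂}) ≥ 2`.

Tubbs §5, p. 126: "we apply Schwartz' lemma on discs of radii `c₃₅ S` and `c₃₆ S^{1+ε}` to obtain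
`log |F^{(t₀)}(y₀)| < -c₃₇ T S² log S`". This file carries out that step for the auxiliary
function of `TubbsPeriodsIndependenceZeroEst.lean`, exactly as the tree does it for Chudnovsky's
theorem on periods (`ChudnovskyAnalytic.lean`, whose statements and proofs are followed line by
line; only the auxiliary function changes):

* `Tubbs.affF` — the meromorphic auxiliary function `F_p(z) = ∑ p_{ijk} zⁱ e^{jcz} ℘(z)ᵏ`
  (`i, k ≤ D`, `j ≤ L₁`); off the lattice the entire function `Tubbs.auxF` of the zero-estimate
  layer is `σ(z)^{3D} F_p(z)` (`auxF_eq`), so orders of vanishing and the first non-vanishing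
  derivative transfer between the two (`forall_iteratedDeriv_auxF_eq_zero_iff`,
  `iteratedDeriv_auxF_eq_of_vanishing`);
* `norm_auxF_le` — growth of order two: `‖auxF(z)‖ ≤ ‖p‖ exp(C (D + L₁ + 1)(1 + |z|²))`;
* `norm_auxF_le_of_zeros` — Schwarz's lemma (`Baker1975.Analytic.norm_le_of_analyticOrderAt`): if
  `auxF` vanishes to order `≥ T` at the `X²` points `ω₁/2 + n₁ω₁ + n₂ω₂` (`n₁, n₂ < X`), then
  `‖auxF(w)‖ ≤ ‖p‖ exp(C (D + L₁ + 1) ϱ²) exp(-T X²)` for `|w| ≤ ϱ`, `ϱ ≥ r₀ X`;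
* `le_norm_weierstrassSigma_add_latt` — the lower bound `‖σ(k + n₁ω₁ + n₂ω₂)‖ ≥ c₁ e^{-C₁ X²}`
  (`n₁, n₂ ≤ X`) on compact sets off the lattice (iterated quasi-periodicity);
* `norm_iteratedDeriv_affF_le_of_zeros` — the fundamental upper bound
  `|F_p^{(j)}(ω₁/2 + n₁ω₁ + n₂ω₂)| ≤ ‖p‖ · j! · exp(C ((D + L₁ + 1) X² + j)) · exp(-T X²)`
  (`n₁, n₂ < X`), by division by `σ^{3D}` on a small circle and Cauchy's inequality.

All constants are existentially quantified and depend only on the lattice and on `c`. Everything is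
PROVED; the only definition is `affF`.

## References

* R. Tubbs, J. Number Theory 35 (1990), §5 pp. 124–127. [Tubbs1990]
* G. V. Chudnovsky, *Contributions to the theory of transcendental numbers* (1984), Ch. 7 §3
  (Schwarz's lemma for `σ^{3L}F`). [Chudnovsky1984]
* A. Baker, *Transcendental Number Theory* (1975), Ch. 2 Lemma 4 (maximum modulus with
  multiplicities). [Baker1975]
-/

noncomputable section

open Complex Metric Set Filter Topology
open scoped PeriodPair

namespace Literature.NumberTheory.Transcendental

namespace Tubbs

variable (L : PeriodPair) (c : ℂ)

/-! ### The meromorphic auxiliary function and its relation to `auxF` -/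

/-- **The auxiliary function** `F_p(z) = ∑ p_{ijk} zⁱ e^{jcz} ℘(z)ᵏ` (meromorphic, poles on the
lattice). [cite: Tubbs1990, §5 Prop. 5.1 (p. 125)] -/
def affF (D L₁ : ℕ) (p : Coeff D L₁ → ℂ) (z : ℂ) : ℂ :=
  ∑ ijk : Coeff D L₁, p ijk * (z ^ (ijk.1 : ℕ) * cexp ((ijk.2.1 : ℕ) * (c * z)) * ℘[L] z ^ (ijk.2.2 : ℕ))

variable {D L₁ : ℕ}

/-- **`auxF = σ^{3D} · F_p` off the lattice.** [folklore] -/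
theorem auxF_eq (p : Coeff D L₁ → ℂ) {z : ℂ} (hz : z ∉ L.lattice) :
    auxF L c D L₁ p z = L.weierstrassSigma z ^ (3 * D) * affF L c D L₁ p z := by
  rw [auxF, affF, Finset.mul_sum]
  refine Finset.sum_congr rfl fun ijk _ => ?_
  obtain ⟨h0, h1, -⟩ := PeriodPair.univExtP_eq hz
  rw [h0, h1]
  have hk : (ijk.2.2 : ℕ) ≤ D := Nat.le_of_lt_succ ijk.2.2.isLt
  have hpow : (L.weierstrassSigma z ^ 3 * ℘[L] z) ^ (ijk.2.2 : ℕ) * (L.weierstrassSigma z ^ 3) ^ (D - ijk.2.2) =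
      L.weierstrassSigma z ^ (3 * D) * ℘[L] z ^ (ijk.2.2 : ℕ) := by
    rw [mul_pow, ← pow_mul, ← pow_mul, show L.weierstrassSigma z ^ (3 * (ijk.2.2 : ℕ)) * ℘[L] z ^ (ijk.2.2 : ℕ) *
      L.weierstrassSigma z ^ (3 * (D - ijk.2.2)) = L.weierstrassSigma z ^ (3 * (ijk.2.2 : ℕ) + 3 * (D - ijk.2.2)) *
        ℘[L] z ^ (ijk.2.2 : ℕ) by ring, ← Nat.mul_add, Nat.add_sub_cancel' hk]
  rw [hpow]; ring

/-- `F_p` is analytic off the lattice. [folklore] -/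
theorem analyticAt_affF (p : Coeff D L₁ → ℂ) {z : ℂ} (hz : z ∉ L.lattice) : AnalyticAt ℂ (affF L c D L₁ p) z := by
  unfold affF
  refine Finset.analyticAt_fun_sum _ fun ijk _ => analyticAt_const.mul ?_
  refine ((analyticAt_id.pow _).mul ?_).mul ((L.analyticOnNhd_weierstrassP z hz).pow _)
  exact analyticAt_cexp.comp (analyticAt_const.mul (analyticAt_const.mul analyticAt_id))

/-- `F_p` is differentiable off the lattice. [folklore] -/
theorem differentiableOn_affF (p : Coeff D L₁ → ℂ) : DifferentiableOn ℂ (affF L c D L₁ p) (L.lattice : Set ℂ)ᶜ :=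
  fun _ hz => (analyticAt_affF L c p hz).differentiableAt.differentiableWithinAt

/-- Near a point off the lattice, `auxF = σ^{3D} F_p`. [folklore] -/
theorem auxF_eventuallyEq (p : Coeff D L₁ → ℂ) {z : ℂ} (hz : z ∉ L.lattice) :
    auxF L c D L₁ p =ᶠ[𝓝 z] fun w => L.weierstrassSigma w ^ (3 * D) * affF L c D L₁ p w := by
  have hopen : IsOpen ((L.lattice : Set ℂ)ᶜ) := L.isClosed_lattice.isOpen_compl
  filter_upwards [hopen.mem_nhds hz] with w hw
  exact auxF_eq L c p hw

/-- `σ` is entire. [folklore] -/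
theorem differentiable_sigma : Differentiable ℂ L.weierstrassSigma := L.differentiable_weierstrassSigma_holds

/-- **Transfer of the order of vanishing** between `auxF` and `F_p` at a point off the lattice. [folklore] -/
theorem forall_iteratedDeriv_auxF_eq_zero_iff (p : Coeff D L₁ → ℂ) {z : ℂ} (hz : z ∉ L.lattice) (T : ℕ) :
    (∀ k < T, iteratedDeriv k (auxF L c D L₁ p) z = 0) ↔ ∀ k < T, iteratedDeriv k (affF L c D L₁ p) z = 0 := by
  -- shift to `0`
  have hshift : ∀ (F : ℂ → ℂ) (k : ℕ), iteratedDeriv k F z = iteratedDeriv k (fun t => F (z + t)) 0 := fun F k => by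
    rw [iteratedDeriv_comp_const_add k F z]
    simp
  have hfa : AnalyticAt ℂ (fun t : ℂ => affF L c D L₁ p (z + t)) 0 :=
    (analyticAt_affF L c p (by simpa using hz)).comp (analyticAt_const.add analyticAt_id)
  have hga : AnalyticAt ℂ (fun t : ℂ => L.weierstrassSigma (z + t) ^ (3 * D)) 0 :=
    (((differentiable_sigma L).analyticAt _).comp (analyticAt_const.add analyticAt_id)).pow _
  have hg0 : L.weierstrassSigma (z + 0) ^ (3 * D) ≠ 0 := by
    rw [add_zero]; exact pow_ne_zero _ (L.weierstrassSigma_ne_zero hz)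
  have key := AnalyticGroupModel.forall_iteratedDeriv_mul_eq_zero_iff_of_ne_zero hfa hga hg0 T
  -- `t ↦ auxF (z + t)` is the product near `0`
  have hprod : (fun t : ℂ => auxF L c D L₁ p (z + t)) =
      fun t => L.weierstrassSigma (z + t) ^ (3 * D) * affF L c D L₁ p (z + t) := by
    funext t
    by_cases ht : z + t ∈ L.lattice
    · -- on the lattice `σ = 0`, and `auxF = 0` as well (`P₀ = σ³`, `P₁ = σ(σ′² - σσ″)` vanish there)
      have hσ : L.weierstrassSigma (z + t) = 0 := L.weierstrassSigma_coe ⟨z + t, ht⟩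
      rcases Nat.eq_zero_or_pos D with hD | hD
      · subst hD
        simp [auxF, affF, hσ]
      · rw [hσ, zero_pow (by omega), zero_mul, auxF]
        refine Finset.sum_eq_zero fun ijk _ => ?_
        have h0 : L.univExtP 0 (z + t) = 0 := by
          rw [PeriodPair.univExtP_zero, PeriodPair.sigmaDeriv_zero_eq, hσ]; simp
        have h1 : L.univExtP 1 (z + t) = 0 := by
          rw [PeriodPair.univExtP_one, PeriodPair.sigmaDeriv_zero_eq, hσ]; simp
        rcases Nat.eq_zero_or_pos (ijk.2.2 : ℕ) with hk | hk
        · rw [hk, Nat.sub_zero, h0, zero_pow (by omega)]; ring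
        · rw [h1, zero_pow (by omega)]; ring
    · exact auxF_eq L c p ht
  constructor
  · intro h k hk
    rw [hshift]
    refine key.mp (fun j hj => ?_) k hk
    rw [← hprod, ← hshift]
    exact h j hj
  · intro h k hk
    rw [hshift, hprod]
    refine key.mpr (fun j hj => ?_) k hk
    rw [← hshift]
    exact h j hj

/-- **The first non-vanishing derivative**: if `F_p^{(j)}(z) = 0` for `j < t₀` then
`auxF^{(t₀)}(z) = σ(z)^{3D} · F_p^{(t₀)}(z)` (Leibniz). [folklore] -/
theorem iteratedDeriv_auxF_eq_of_vanishing (p : Coeff D L₁ → ℂ) {z : ℂ} (hz : z ∉ L.lattice) {t₀ : ℕ}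
    (h : ∀ k < t₀, iteratedDeriv k (affF L c D L₁ p) z = 0) :
    iteratedDeriv t₀ (auxF L c D L₁ p) z = L.weierstrassSigma z ^ (3 * D) * iteratedDeriv t₀ (affF L c D L₁ p) z := by
  rw [(auxF_eventuallyEq L c p hz).iteratedDeriv_eq]
  have hf : ContDiffAt ℂ t₀ (affF L c D L₁ p) z := (analyticAt_affF L c p hz).contDiffAt
  have hg : ContDiffAt ℂ t₀ (fun w => L.weierstrassSigma w ^ (3 * D)) z :=
    (((differentiable_sigma L).analyticAt z).pow _).contDiffAt
  rw [show (fun w => L.weierstrassSigma w ^ (3 * D) * affF L c D L₁ p w) =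
    (fun w => L.weierstrassSigma w ^ (3 * D)) * affF L c D L₁ p from rfl, iteratedDeriv_mul hg hf,
    Finset.sum_range_succ', Finset.sum_eq_zero fun i hi => ?_]
  · rw [Nat.choose_zero_right, Nat.cast_one, one_mul, Nat.sub_zero, iteratedDeriv_zero, zero_add]
  · rw [Finset.mem_range] at hi
    rw [h (t₀ - (i + 1)) (by omega), mul_zero]

/-! ### Growth of `auxF` -/

/-- `‖p_{ijk}‖ ≤ ‖p‖`. [folklore] -/
theorem norm_apply_le (p : Coeff D L₁ → ℂ) (l : Coeff D L₁) : ‖p l‖ ≤ ‖p‖ := norm_le_pi_norm p l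

/-- `t ≤ exp(1 + t²)`. [folklore] -/
theorem le_exp_one_add_sq (t : ℝ) : t ≤ Real.exp (1 + t ^ 2) := by
  have := Chudnovsky.one_add_le_exp_one_add_sq t
  linarith

/-- **Growth of `auxF`**: `‖auxF(z)‖ ≤ ‖p‖ exp(C (D + L₁ + 1)(1 + |z|²))`, with `C` depending only
on the lattice and `c` (`(D+1)²(L₁+1)` terms, each `zⁱ e^{jcz}` times a product of `D` blocks of
order two). [cite: Tubbs1990, §5 p. 126] -/
theorem norm_auxF_le :
    ∃ C : ℝ, 0 ≤ C ∧ ∀ (D L₁ : ℕ) (p : Coeff D L₁ → ℂ) (z : ℂ),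
      ‖auxF L c D L₁ p z‖ ≤ ‖p‖ * Real.exp (C * (D + L₁ + 1) * (1 + ‖z‖ ^ 2)) := by
  obtain ⟨C₀, hC₀, hP⟩ := L.exists_norm_univExtP_univExtZ_le
  refine ⟨C₀ + ‖c‖ + 3, by positivity, fun D L₁ p z => ?_⟩
  set t : ℝ := 1 + ‖z‖ ^ 2 with ht
  have ht1 : 1 ≤ t := by rw [ht]; nlinarith [norm_nonneg z]
  have hzt : ‖z‖ ≤ t := by rw [ht]; nlinarith [norm_nonneg z, sq_nonneg (‖z‖ - 1)]
  set E : ℝ := Real.exp (C₀ * t) with hE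
  have hE1 : 1 ≤ E := Real.one_le_exp (by positivity)
  -- each term
  have hterm : ∀ l : Coeff D L₁,
      ‖p l * (z ^ (l.1 : ℕ) * cexp ((l.2.1 : ℕ) * (c * z)) * (L.univExtP 1 z ^ (l.2.2 : ℕ) * L.univExtP 0 z ^ (D - l.2.2)))‖ ≤
        ‖p‖ * (Real.exp (D * t) * Real.exp (L₁ * ‖c‖ * t) * E ^ D) := by
    intro l
    have hl1 : (l.1 : ℕ) ≤ D := Nat.lt_succ_iff.mp l.1.isLt
    have hl2 : (l.2.1 : ℕ) ≤ L₁ := Nat.lt_succ_iff.mp l.2.1.isLt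
    have hl3 : (l.2.2 : ℕ) ≤ D := Nat.lt_succ_iff.mp l.2.2.isLt
    rw [norm_mul]
    refine mul_le_mul (norm_apply_le p l) ?_ (norm_nonneg _) (norm_nonneg _)
    rw [norm_mul, norm_mul]
    refine mul_le_mul (mul_le_mul ?_ ?_ (norm_nonneg _) (by positivity)) ?_ (norm_nonneg _) (by positivity)
    · -- `‖z‖^i ≤ exp(t)^i ≤ exp(D t)`
      rw [norm_pow]
      calc ‖z‖ ^ (l.1 : ℕ) ≤ Real.exp t ^ (l.1 : ℕ) :=
            pow_le_pow_left₀ (norm_nonneg _) (hzt.trans (by linarith [Real.add_one_le_exp t])) _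
        _ ≤ Real.exp t ^ D := pow_le_pow_right₀ (Real.one_le_exp (by linarith)) hl1
        _ = Real.exp (D * t) := by rw [← Real.exp_nat_mul]
    · -- `‖e^{jcz}‖ ≤ exp(L₁ ‖c‖ t)`
      rw [Complex.norm_exp]
      refine Real.exp_le_exp.mpr ?_
      calc ((l.2.1 : ℕ) * (c * z)).re ≤ ‖((l.2.1 : ℕ) : ℂ) * (c * z)‖ := Complex.re_le_norm _
        _ = (l.2.1 : ℕ) * (‖c‖ * ‖z‖) := by rw [norm_mul, norm_mul, Complex.norm_natCast]
        _ ≤ L₁ * (‖c‖ * t) := by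
            refine mul_le_mul (by exact_mod_cast hl2) (mul_le_mul_of_nonneg_left hzt (norm_nonneg _))
              (by positivity) (by positivity)
        _ = L₁ * ‖c‖ * t := by ring
    · -- the blocks
      rw [norm_mul, norm_pow, norm_pow]
      calc ‖L.univExtP 1 z‖ ^ (l.2.2 : ℕ) * ‖L.univExtP 0 z‖ ^ (D - l.2.2) ≤ E ^ (l.2.2 : ℕ) * E ^ (D - l.2.2) := by
            gcongr
            · exact (hP 1 z).1
            · exact (hP 0 z).1
        _ = E ^ D := by rw [← pow_add, Nat.add_sub_cancel' hl3]
  have hcard : (Finset.univ : Finset (Coeff D L₁)).card = (D + 1) * ((L₁ + 1) * (D + 1)) := by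
    simp [Coeff, Fintype.card_prod, Fintype.card_fin]
  have hn : ∀ n : ℕ, ((n + 1 : ℕ) : ℝ) ≤ Real.exp ((n + 1 : ℕ) * t) := fun n =>
    calc ((n + 1 : ℕ) : ℝ) ≤ (n + 1 : ℕ) * t := le_mul_of_one_le_right (by positivity) ht1
      _ ≤ (n + 1 : ℕ) * t + 1 := by linarith
      _ ≤ Real.exp ((n + 1 : ℕ) * t) := Real.add_one_le_exp _
  calc ‖auxF L c D L₁ p z‖ ≤ ∑ l, ‖p l * (z ^ (l.1 : ℕ) * cexp ((l.2.1 : ℕ) * (c * z)) *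
        (L.univExtP 1 z ^ (l.2.2 : ℕ) * L.univExtP 0 z ^ (D - l.2.2)))‖ := norm_sum_le _ _
    _ ≤ ∑ _l : Coeff D L₁, ‖p‖ * (Real.exp (D * t) * Real.exp (L₁ * ‖c‖ * t) * E ^ D) :=
        Finset.sum_le_sum fun l _ => hterm l
    _ = ((D + 1 : ℕ) * (((L₁ + 1 : ℕ) : ℝ) * (D + 1 : ℕ))) * (‖p‖ * (Real.exp (D * t) * Real.exp (L₁ * ‖c‖ * t) * E ^ D)) := by
        rw [Finset.sum_const, hcard, nsmul_eq_mul]; push_cast; ring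
    _ ≤ (Real.exp ((D + 1 : ℕ) * t) * (Real.exp ((L₁ + 1 : ℕ) * t) * Real.exp ((D + 1 : ℕ) * t))) *
        (‖p‖ * (Real.exp (D * t) * Real.exp (L₁ * ‖c‖ * t) * E ^ D)) := by
        gcongr
        · exact hn D
        · exact hn L₁
        · exact hn D
    _ = ‖p‖ * (Real.exp ((D + 1 : ℕ) * t) * Real.exp ((L₁ + 1 : ℕ) * t) * Real.exp ((D + 1 : ℕ) * t) *
        Real.exp (D * t) * Real.exp (L₁ * ‖c‖ * t) * E ^ D) := by ring
    _ = ‖p‖ * Real.exp (((D + 1 : ℕ) + (L₁ + 1 : ℕ) + (D + 1 : ℕ) + D + L₁ * ‖c‖ + C₀ * D) * t) := by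
        congr 1
        rw [hE, ← Real.exp_nat_mul, ← Real.exp_add, ← Real.exp_add, ← Real.exp_add, ← Real.exp_add,
          ← Real.exp_add]
        congr 1
        push_cast
        ring
    _ ≤ ‖p‖ * Real.exp ((C₀ + ‖c‖ + 3) * (D + L₁ + 1) * t) := by
        refine mul_le_mul_of_nonneg_left (Real.exp_le_exp.mpr ?_) (norm_nonneg _)
        push_cast
        have hD : (0 : ℝ) ≤ D := Nat.cast_nonneg D
        have hL : (0 : ℝ) ≤ L₁ := Nat.cast_nonneg L₁
        have ht0 : 0 ≤ t := by linarith
        nlinarith [mul_nonneg hD ht0, mul_nonneg hL ht0, mul_nonneg (mul_nonneg hC₀ hL) ht0,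
          mul_nonneg (mul_nonneg (norm_nonneg c) hD) ht0, mul_nonneg hC₀ ht0, mul_nonneg (norm_nonneg c) ht0]

/-! ### The points `ω₁/2 + n₁ω₁ + n₂ω₂` and Schwarz's lemma -/

/-- `‖ω₁/2 + y_n + u‖ ≤ r₀ X` for `n₁, n₂ < X`, `‖u‖ ≤ 1` (`r₀ = 2‖ω₁‖ + ‖ω₂‖ + 2`). [folklore] -/
theorem norm_halfPeriod_add_latt_le {X : ℕ} (hX : 1 ≤ X) {n₁ n₂ : ℕ} (hn₁ : n₁ < X) (hn₂ : n₂ < X)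
    {u : ℂ} (hu : ‖u‖ ≤ 1) : ‖L.ω₁ / 2 + latt L n₁ n₂ + u‖ ≤ Chudnovsky.r₀ L * X := by
  have hX' : (1 : ℝ) ≤ X := by exact_mod_cast hX
  have h1 : (n₁ : ℝ) ≤ X := by exact_mod_cast hn₁.le
  have h2 : (n₂ : ℝ) ≤ X := by exact_mod_cast hn₂.le
  calc ‖L.ω₁ / 2 + latt L n₁ n₂ + u‖ ≤ ‖L.ω₁ / 2‖ + ‖latt L n₁ n₂‖ + ‖u‖ := norm_add₃_le
    _ ≤ ‖L.ω₁‖ / 2 + (n₁ * ‖L.ω₁‖ + n₂ * ‖L.ω₂‖) + 1 := by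
        gcongr
        · simp
        · unfold latt
          calc ‖(n₁ : ℂ) * L.ω₁ + n₂ * L.ω₂‖ ≤ ‖(n₁ : ℂ) * L.ω₁‖ + ‖(n₂ : ℂ) * L.ω₂‖ := norm_add_le _ _
            _ = n₁ * ‖L.ω₁‖ + n₂ * ‖L.ω₂‖ := by rw [norm_mul, norm_mul, Complex.norm_natCast, Complex.norm_natCast]
    _ ≤ ‖L.ω₁‖ * X + (X * ‖L.ω₁‖ + X * ‖L.ω₂‖) + 2 * X := by
        gcongr
        · nlinarith [norm_nonneg L.ω₁]
        · linarith
    _ = Chudnovsky.r₀ L * X := by unfold Chudnovsky.r₀; ring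

/-- The points `ω₁/2 + y_n`, `n₁, n₂ < X`, as a finite set. [folklore] -/
def zeroPts (X : ℕ) : Finset ℂ :=
  ((Finset.range X) ×ˢ (Finset.range X)).image fun q => L.ω₁ / 2 + latt L q.1 q.2

/-- `#zeroPts X = X²`. [folklore] -/
theorem card_zeroPts (X : ℕ) : (zeroPts L X).card = X ^ 2 := by
  unfold zeroPts
  rw [Finset.card_image_of_injective, Finset.card_product, Finset.card_range, sq]
  rintro ⟨a, b⟩ ⟨a', b'⟩ h
  obtain ⟨h1, h2⟩ := latt_injective L (add_left_cancel h)
  exact Prod.ext h1 h2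

/-- Membership in `zeroPts`. [folklore] -/
theorem mem_zeroPts {X : ℕ} {x : ℂ} (hx : x ∈ zeroPts L X) :
    ∃ n₁ n₂ : ℕ, n₁ < X ∧ n₂ < X ∧ x = L.ω₁ / 2 + latt L n₁ n₂ := by
  unfold zeroPts at hx
  simp only [Finset.mem_image, Finset.mem_product, Finset.mem_range, Prod.exists] at hx
  obtain ⟨a, b, ⟨ha, hb⟩, rfl⟩ := hx
  exact ⟨a, b, ha, hb, rfl⟩

/-- The points `ω₁/2 + y_n` are off the lattice. [folklore] -/
theorem halfPeriod_add_latt_notMem (n₁ n₂ : ℕ) : L.ω₁ / 2 + latt L n₁ n₂ ∉ L.lattice := fun h =>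
  L.ω₁_div_two_notMem_lattice (by simpa using L.lattice.sub_mem h (latt_mem_lattice L n₁ n₂))

/-- `(1/3)^k ≤ exp(-k)`. [folklore] -/
theorem third_pow_le_exp_neg (k : ℕ) : (1 / 3 : ℝ) ^ k ≤ Real.exp (-(k : ℝ)) := by
  have h3 : (1 / 3 : ℝ) ≤ Real.exp (-1) := by
    rw [Real.exp_neg, one_div]
    refine inv_anti₀ (Real.exp_pos 1) ?_
    have := Real.exp_one_lt_d9
    linarith
  calc (1 / 3 : ℝ) ^ k ≤ Real.exp (-1) ^ k := pow_le_pow_left₀ (by norm_num) h3 k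
    _ = Real.exp (-(k : ℝ)) := by rw [← Real.exp_nat_mul]; ring_nf

/-- **Schwarz's lemma for `auxF`.** If `auxF^{(j)}(ω₁/2 + y_n) = 0` for `j < T`, `n₁, n₂ < X`
(`X ≥ 1`), then for every `ϱ ≥ r₀ X` and `|w| ≤ ϱ`, `‖auxF(w)‖ ≤ ‖p‖ exp(C (D+L₁+1) ϱ²) exp(-T X²)`:
`auxF` has `X²` zeros of order `≥ T` in `|z| ≤ ϱ`, compared with the circle `|z| = 7ϱ`.
[cite: Tubbs1990, §5 p. 126] [cite: Chudnovsky1984, Ch. 7 Thm 3.1 p. 309] -/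
theorem norm_auxF_le_of_zeros :
    ∃ C : ℝ, 0 ≤ C ∧ ∀ (D L₁ X T : ℕ), 1 ≤ X → ∀ p : Coeff D L₁ → ℂ,
      (∀ n₁ n₂ : ℕ, n₁ < X → n₂ < X → ∀ j < T, iteratedDeriv j (auxF L c D L₁ p) (L.ω₁ / 2 + latt L n₁ n₂) = 0) →
      ∀ ϱ : ℝ, Chudnovsky.r₀ L * X ≤ ϱ → ∀ w : ℂ, ‖w‖ ≤ ϱ →
        ‖auxF L c D L₁ p w‖ ≤ ‖p‖ * Real.exp (C * (D + L₁ + 1) * ϱ ^ 2) * Real.exp (-(T * X ^ 2 : ℝ)) := by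
  obtain ⟨C, hC, hG⟩ := norm_auxF_le L c
  refine ⟨50 * C, by positivity, fun D L₁ X T hX p hF ϱ hϱ w hw => ?_⟩
  have hX' : (1 : ℝ) ≤ X := by exact_mod_cast hX
  have hϱ2 : 2 ≤ ϱ := by nlinarith [Chudnovsky.two_le_r₀ L]
  have hϱ0 : 0 < ϱ := by linarith
  set S := zeroPts L X with hS
  have hcS : ∀ x ∈ S, ‖x‖ ≤ ϱ := by
    intro x hx
    obtain ⟨n₁, n₂, h1, h2, rfl⟩ := mem_zeroPts L hx
    have := norm_halfPeriod_add_latt_le L hX h1 h2 (u := 0) (by simp)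
    rw [add_zero] at this
    exact this.trans hϱ
  have hord : ∀ x ∈ S, (T : ℕ∞) ≤ analyticOrderAt (auxF L c D L₁ p) x := by
    intro x hx
    obtain ⟨n₁, n₂, h1, h2, rfl⟩ := mem_zeroPts L hx
    exact (natCast_le_analyticOrderAt_iff_iteratedDeriv_eq_zero
      ((differentiable_auxF L c D L₁ p).analyticAt _)).mpr (hF n₁ n₂ h1 h2)
  set θ : ℝ := ‖p‖ * Real.exp (C * (D + L₁ + 1) * (1 + (7 * ϱ) ^ 2)) with hθ
  have hθb : ∀ z ∈ sphere (0 : ℂ) (7 * ϱ), ‖auxF L c D L₁ p z‖ ≤ θ := by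
    intro z hz
    rw [mem_sphere_zero_iff_norm] at hz
    have := hG D L₁ p z
    rwa [hz] at this
  have hmF : ∀ z ∈ sphere (0 : ℂ) (7 * ϱ), (6 * ϱ) ^ (T * S.card) ≤ ‖∏ x ∈ S, (z - x) ^ T‖ := by
    intro z hz
    rw [mem_sphere_zero_iff_norm] at hz
    refine Baker1975.Analytic.le_norm_prod_pow S T (by positivity) fun x hx => ?_
    calc 6 * ϱ = 7 * ϱ - ϱ := by ring
      _ ≤ ‖z‖ - ‖x‖ := by rw [hz]; linarith [hcS x hx]
      _ ≤ ‖z - x‖ := norm_sub_norm_le z x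
  have hwF : ‖∏ x ∈ S, (w - x) ^ T‖ ≤ (2 * ϱ) ^ (T * S.card) :=
    Baker1975.Analytic.norm_prod_pow_le S T fun x hx =>
      calc ‖w - x‖ ≤ ‖w‖ + ‖x‖ := norm_sub_le w x
        _ ≤ 2 * ϱ := by linarith [hcS x hx]
  have hm0 : (0 : ℝ) < (6 * ϱ) ^ (T * S.card) := by positivity
  have key := Baker1975.Analytic.norm_le_of_analyticOrderAt (differentiable_auxF L c D L₁ p) S T hord
    (R := 7 * ϱ) (by positivity) hθb hm0 hmF (w := w) (by linarith)
  have hratio : θ / (6 * ϱ) ^ (T * S.card) * ‖∏ x ∈ S, (w - x) ^ T‖ ≤ θ * Real.exp (-(T * X ^ 2 : ℝ)) := by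
    have hθ0 : 0 ≤ θ := by positivity
    calc θ / (6 * ϱ) ^ (T * S.card) * ‖∏ x ∈ S, (w - x) ^ T‖
        ≤ θ / (6 * ϱ) ^ (T * S.card) * (2 * ϱ) ^ (T * S.card) := by gcongr
      _ = θ * ((2 * ϱ) / (6 * ϱ)) ^ (T * S.card) := by rw [div_pow]; field_simp
      _ = θ * (1 / 3) ^ (T * S.card) := by
          have h12 : (2 * ϱ) / (6 * ϱ) = (1 / 3 : ℝ) := by field_simp; ring
          rw [h12]
      _ = θ * (1 / 3) ^ (T * X ^ 2) := by rw [hS, card_zeroPts]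
      _ ≤ θ * Real.exp (-(T * X ^ 2 : ℝ)) := by
          refine mul_le_mul_of_nonneg_left ?_ hθ0
          have := third_pow_le_exp_neg (T * X ^ 2)
          push_cast at this
          exact this
  have hθle : θ ≤ ‖p‖ * Real.exp (50 * C * (D + L₁ + 1) * ϱ ^ 2) := by
    rw [hθ]
    refine mul_le_mul_of_nonneg_left (Real.exp_le_exp.mpr ?_) (norm_nonneg _)
    have hϱ1 : 1 ≤ ϱ ^ 2 := by nlinarith
    have hD0 : (0 : ℝ) ≤ C * (D + L₁ + 1) := by positivity
    nlinarith [mul_le_mul_of_nonneg_left hϱ1 hD0]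
  calc ‖auxF L c D L₁ p w‖ ≤ θ / (6 * ϱ) ^ (T * S.card) * ‖∏ x ∈ S, (w - x) ^ T‖ := key
    _ ≤ θ * Real.exp (-(T * X ^ 2 : ℝ)) := hratio
    _ ≤ ‖p‖ * Real.exp (50 * C * (D + L₁ + 1) * ϱ ^ 2) * Real.exp (-(T * X ^ 2 : ℝ)) := by gcongr

/-! ### Lower bound for `σ` at the points `k + n₁ω₁ + n₂ω₂` -/

/-- The quadratic exponent of the quasi-periodicity is bounded by `‖η‖(n‖w‖ + n²‖ω‖)` in absolute
value. [folklore] -/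
theorem neg_le_re_exponent (η ω w : ℂ) (n : ℕ) :
    -(‖η‖ * (n * ‖w‖ + n ^ 2 * ‖ω‖)) ≤ (η * (n * w + n ^ 2 * ω / 2)).re := by
  have hre : |(η * (n * w + n ^ 2 * ω / 2)).re| ≤ ‖η‖ * ((n : ℝ) * ‖w‖ + (n : ℝ) ^ 2 * ‖ω‖) := by
    refine (Complex.abs_re_le_norm _).trans ?_
    rw [norm_mul]
    refine mul_le_mul_of_nonneg_left ((norm_add_le _ _).trans ?_) (norm_nonneg _)
    rw [norm_mul, Complex.norm_natCast, norm_div, norm_mul, norm_pow, Complex.norm_natCast, Complex.norm_two]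
    have : 0 ≤ (n : ℝ) ^ 2 * ‖ω‖ := by positivity
    linarith
  linarith [neg_abs_le ((η * (n * w + n ^ 2 * ω / 2)).re)]

/-- **Lower bound along lattice translates**: for a compact `K` off the lattice there are `c₁ > 0`,
`C₁ ≥ 0` with `‖σ(k + n₁ω₁ + n₂ω₂)‖ ≥ c₁ exp(-C₁ X²)` for `k ∈ K`, `n₁, n₂ ≤ X` (iterated
quasi-periodicity in `ω₁` then `ω₂`, and `min_K ‖σ‖ > 0`). [cite: Chudnovsky1984, Ch. 7 Thm 3.1 p. 310] -/
theorem le_norm_weierstrassSigma_add_latt {K : Set ℂ} (hK : IsCompact K) (hKΛ : ∀ k ∈ K, k ∉ L.lattice) :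
    ∃ c₁ : ℝ, 0 < c₁ ∧ ∃ C₁ : ℝ, 0 ≤ C₁ ∧ ∀ k ∈ K, ∀ n₁ n₂ X : ℕ, n₁ ≤ X → n₂ ≤ X →
      c₁ * Real.exp (-(C₁ * (X : ℝ) ^ 2)) ≤ ‖L.weierstrassSigma (k + latt L n₁ n₂)‖ := by
  rcases K.eq_empty_or_nonempty with rfl | hne
  · exact ⟨1, one_pos, 0, le_rfl, fun k hk => (Set.notMem_empty k hk).elim⟩
  have hcont : ContinuousOn (fun z => ‖L.weierstrassSigma z‖) K := (differentiable_sigma L).continuous.norm.continuousOn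
  obtain ⟨k₀, hk₀, hmin⟩ := hK.exists_isMinOn hne hcont
  obtain ⟨ρ, hρ⟩ := hK.isBounded.exists_norm_le
  have hc0 : 0 < ‖L.weierstrassSigma k₀‖ := norm_pos_iff.mpr (L.weierstrassSigma_ne_zero (hKΛ k₀ hk₀))
  set ρ' := max ρ 0 with hρ'
  -- the constant: `‖η₁‖(ρ' + ‖ω₁‖) + ‖η₂‖(ρ' + ‖ω₁‖ + ‖ω₂‖)`
  refine ⟨‖L.weierstrassSigma k₀‖, hc0, ‖L.η₁‖ * (ρ' + ‖L.ω₁‖) + ‖L.η₂‖ * (ρ' + ‖L.ω₁‖ + ‖L.ω₂‖), by positivity,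
    fun k hk n₁ n₂ X hn₁ hn₂ => ?_⟩
  have hkρ : ‖k‖ ≤ ρ' := (hρ k hk).trans (le_max_left _ _)
  have hρ'0 : 0 ≤ ρ' := le_max_right _ _
  have hσk : ‖L.weierstrassSigma k₀‖ ≤ ‖L.weierstrassSigma k‖ := isMinOn_iff.mp hmin k hk
  have hn₁' : (n₁ : ℝ) ≤ X := by exact_mod_cast hn₁
  have hn₂' : (n₂ : ℝ) ≤ X := by exact_mod_cast hn₂
  have hX0 : (0 : ℝ) ≤ X := Nat.cast_nonneg X
  -- step 1: translate by `n₁ω₁`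
  have e1 : ‖L.weierstrassSigma (k + n₁ * L.ω₁)‖ =
      Real.exp ((L.η₁ * (n₁ * k + n₁ ^ 2 * L.ω₁ / 2)).re) * ‖L.weierstrassSigma k‖ :=
    L.norm_weierstrassSigma_add_nat_mul L.weierstrassSigma_add_ω₁_holds n₁ k
  -- step 2: translate by `n₂ω₂`
  have e2 : ‖L.weierstrassSigma (k + n₁ * L.ω₁ + n₂ * L.ω₂)‖ =
      Real.exp ((L.η₂ * (n₂ * (k + n₁ * L.ω₁) + n₂ ^ 2 * L.ω₂ / 2)).re) * ‖L.weierstrassSigma (k + n₁ * L.ω₁)‖ :=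
    L.norm_weierstrassSigma_add_nat_mul L.weierstrassSigma_add_ω₂_holds n₂ (k + n₁ * L.ω₁)
  have hlatt : k + latt L n₁ n₂ = k + n₁ * L.ω₁ + n₂ * L.ω₂ := by unfold latt; ring
  rw [hlatt, e2, e1]
  -- bounds on the exponents
  have hw1 : ‖k + n₁ * L.ω₁‖ ≤ ρ' + X * ‖L.ω₁‖ := by
    calc ‖k + n₁ * L.ω₁‖ ≤ ‖k‖ + ‖(n₁ : ℂ) * L.ω₁‖ := norm_add_le _ _
      _ = ‖k‖ + n₁ * ‖L.ω₁‖ := by rw [norm_mul, Complex.norm_natCast]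
      _ ≤ ρ' + X * ‖L.ω₁‖ := by gcongr
  have hE1 := neg_le_re_exponent L.η₁ L.ω₁ k n₁
  have hE2 := neg_le_re_exponent L.η₂ L.ω₂ (k + n₁ * L.ω₁) n₂
  have hXX : (X : ℝ) ≤ (X : ℝ) ^ 2 := by
    rcases Nat.eq_zero_or_pos X with h0 | hpos
    · simp [h0]
    · have : (1 : ℝ) ≤ X := by exact_mod_cast hpos
      nlinarith
  have hXρ : (X : ℝ) * ρ' ≤ (X : ℝ) ^ 2 * ρ' := mul_le_mul_of_nonneg_right hXX hρ'0
  have hb1 : ‖L.η₁‖ * (n₁ * ‖k‖ + n₁ ^ 2 * ‖L.ω₁‖) ≤ ‖L.η₁‖ * (ρ' + ‖L.ω₁‖) * X ^ 2 := by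
    have h1 : (n₁ : ℝ) * ‖k‖ ≤ X * ρ' := by gcongr
    have h2 : (n₁ : ℝ) ^ 2 * ‖L.ω₁‖ ≤ X ^ 2 * ‖L.ω₁‖ := by gcongr
    have h3 : (n₁ : ℝ) * ‖k‖ + n₁ ^ 2 * ‖L.ω₁‖ ≤ (ρ' + ‖L.ω₁‖) * X ^ 2 := by nlinarith
    calc ‖L.η₁‖ * (n₁ * ‖k‖ + n₁ ^ 2 * ‖L.ω₁‖) ≤ ‖L.η₁‖ * ((ρ' + ‖L.ω₁‖) * X ^ 2) :=
          mul_le_mul_of_nonneg_left h3 (norm_nonneg _)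
      _ = _ := by ring
  have hb2 : ‖L.η₂‖ * (n₂ * ‖k + n₁ * L.ω₁‖ + n₂ ^ 2 * ‖L.ω₂‖) ≤ ‖L.η₂‖ * (ρ' + ‖L.ω₁‖ + ‖L.ω₂‖) * X ^ 2 := by
    have h1 : (n₂ : ℝ) * ‖k + n₁ * L.ω₁‖ ≤ X * (ρ' + X * ‖L.ω₁‖) := by gcongr
    have h2 : (n₂ : ℝ) ^ 2 * ‖L.ω₂‖ ≤ X ^ 2 * ‖L.ω₂‖ := by gcongr
    have h3 : (n₂ : ℝ) * ‖k + n₁ * L.ω₁‖ + n₂ ^ 2 * ‖L.ω₂‖ ≤ (ρ' + ‖L.ω₁‖ + ‖L.ω₂‖) * X ^ 2 := by nlinarith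
    calc ‖L.η₂‖ * (n₂ * ‖k + n₁ * L.ω₁‖ + n₂ ^ 2 * ‖L.ω₂‖) ≤ ‖L.η₂‖ * ((ρ' + ‖L.ω₁‖ + ‖L.ω₂‖) * X ^ 2) :=
          mul_le_mul_of_nonneg_left h3 (norm_nonneg _)
      _ = _ := by ring
  -- assemble
  rw [← mul_assoc, mul_comm ‖L.weierstrassSigma k₀‖]
  refine mul_le_mul ?_ hσk (norm_nonneg _) (by positivity)
  rw [← Real.exp_add]
  exact Real.exp_le_exp.mpr (by linarith [hE1, hE2, hb1, hb2])

/-! ### Division by `σ^{3D}` and Cauchy's inequality -/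

/-- Off the lattice, `‖F_p(z)‖ = ‖auxF(z)‖ / ‖σ(z)‖^{3D}`. [folklore] -/
theorem norm_affF_eq (p : Coeff D L₁ → ℂ) {z : ℂ} (hz : z ∉ L.lattice) :
    ‖affF L c D L₁ p z‖ = ‖auxF L c D L₁ p z‖ / ‖L.weierstrassSigma z‖ ^ (3 * D) := by
  have hσ := L.weierstrassSigma_ne_zero hz
  rw [auxF_eq L c p hz, norm_mul, norm_pow]
  field_simp

/-- Division step: a lower bound `c₀ e^{-C' N²} ≤ ‖σ(z)‖` (`0 < c₀ ≤ 1`, `N ≥ 1`) turns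
`‖auxF(z)‖ ≤ A` into `‖F_p(z)‖ ≤ A exp(3 (log c₀⁻¹ + C') (D+1) N²)`. [folklore] -/
theorem norm_affF_le_of_sigma_lower (p : Coeff D L₁ → ℂ) {z : ℂ} (hz : z ∉ L.lattice)
    {A c₀ C' : ℝ} (hA : ‖auxF L c D L₁ p z‖ ≤ A) (hA0 : 0 ≤ A) (hc₀ : 0 < c₀) (hc₁ : c₀ ≤ 1) (hC' : 0 ≤ C')
    {N : ℝ} (hN : 1 ≤ N) (hσ : c₀ * Real.exp (-(C' * N ^ 2)) ≤ ‖L.weierstrassSigma z‖) :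
    ‖affF L c D L₁ p z‖ ≤ A * Real.exp (3 * (Real.log c₀⁻¹ + C') * (D + 1) * N ^ 2) := by
  rw [norm_affF_eq L c p hz]
  have hlow : 0 < c₀ * Real.exp (-(C' * N ^ 2)) := by positivity
  have hσpos : 0 < ‖L.weierstrassSigma z‖ := hlow.trans_le hσ
  rw [div_le_iff₀ (pow_pos hσpos _)]
  have h1 : Real.exp (-(Real.log c₀⁻¹ + C' * N ^ 2)) ≤ ‖L.weierstrassSigma z‖ := by
    refine le_trans ?_ hσ
    rw [neg_add, Real.exp_add, Real.exp_neg, Real.exp_log (by positivity), inv_inv]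
  have h2 : Real.exp (-(3 * D * (Real.log c₀⁻¹ + C' * N ^ 2))) ≤ ‖L.weierstrassSigma z‖ ^ (3 * D) := by
    calc Real.exp (-(3 * D * (Real.log c₀⁻¹ + C' * N ^ 2)))
        = Real.exp (-(Real.log c₀⁻¹ + C' * N ^ 2)) ^ (3 * D) := by
          rw [← Real.exp_nat_mul]; push_cast; ring_nf
      _ ≤ ‖L.weierstrassSigma z‖ ^ (3 * D) := pow_le_pow_left₀ (by positivity) h1 _
  have hlog : 0 ≤ Real.log c₀⁻¹ := Real.log_nonneg (one_le_inv₀ hc₀ |>.mpr hc₁)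
  have h3 : 3 * D * (Real.log c₀⁻¹ + C' * N ^ 2) ≤ 3 * (Real.log c₀⁻¹ + C') * (D + 1) * N ^ 2 := by
    have hN1 : 1 ≤ N ^ 2 := by nlinarith
    have hD : (0 : ℝ) ≤ D := by positivity
    nlinarith [mul_nonneg hD hlog, mul_nonneg hD hC']
  calc ‖auxF L c D L₁ p z‖ ≤ A := hA
    _ = A * (Real.exp (3 * (Real.log c₀⁻¹ + C') * (D + 1) * N ^ 2) *
        Real.exp (-(3 * (Real.log c₀⁻¹ + C') * (D + 1) * N ^ 2))) := by
          rw [← Real.exp_add, add_neg_cancel, Real.exp_zero, mul_one]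
    _ ≤ A * (Real.exp (3 * (Real.log c₀⁻¹ + C') * (D + 1) * N ^ 2) *
        Real.exp (-(3 * D * (Real.log c₀⁻¹ + C' * N ^ 2)))) := by gcongr
    _ ≤ A * (Real.exp (3 * (Real.log c₀⁻¹ + C') * (D + 1) * N ^ 2) * ‖L.weierstrassSigma z‖ ^ (3 * D)) := by gcongr
    _ = A * Real.exp (3 * (Real.log c₀⁻¹ + C') * (D + 1) * N ^ 2) * ‖L.weierstrassSigma z‖ ^ (3 * D) := by ring

/-- **The fundamental upper bound** (Tubbs 1990, §5 p. 126: "`log |F^{(t₀)}(y₀)| < -c₃₇TS² log S`";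
Chudnovsky 1984, Ch. 7, (2.5)). If `auxF^{(j)}(ω₁/2 + y_n) = 0` for `j < T`, `n₁, n₂ < X` (`X ≥ 1`),
then for every `n₁⁰, n₂⁰ < X` and every `j`,
`|F_p^{(j)}(ω₁/2 + y_{n⁰})| ≤ ‖p‖ · j! · exp(C ((D+L₁+1) X² + j)) · exp(-T X²)`, by Schwarz's lemma for
`auxF`, division by `σ^{3D}` on a small circle around the point and Cauchy's inequality.
[cite: Tubbs1990, §5 (p. 126)] [cite: Chudnovsky1984, Ch. 7 Thm 3.1 p. 309] -/
theorem norm_iteratedDeriv_affF_le_of_zeros :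
    ∃ C : ℝ, 0 ≤ C ∧ ∀ (D L₁ X T : ℕ), 1 ≤ X → ∀ p : Coeff D L₁ → ℂ,
      (∀ n₁ n₂ : ℕ, n₁ < X → n₂ < X → ∀ j < T, iteratedDeriv j (auxF L c D L₁ p) (L.ω₁ / 2 + latt L n₁ n₂) = 0) →
      ∀ n₁ n₂ : ℕ, n₁ < X → n₂ < X → ∀ j : ℕ,
        ‖iteratedDeriv j (affF L c D L₁ p) (L.ω₁ / 2 + latt L n₁ n₂)‖ ≤
          ‖p‖ * j.factorial * Real.exp (C * ((D + L₁ + 1) * X ^ 2 + j)) * Real.exp (-(T * X ^ 2 : ℝ)) := by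
  obtain ⟨δ, hδ, hδ1, hball⟩ := Chudnovsky.exists_closedBall_subset_compl_lattice L
  obtain ⟨CA, hCA, hA⟩ := norm_auxF_le_of_zeros L c
  have hKc : IsCompact (sphere (L.ω₁ / 2) δ) := isCompact_sphere _ _
  have hKΛ : ∀ k ∈ sphere (L.ω₁ / 2) δ, k ∉ L.lattice := fun k hk => hball (sphere_subset_closedBall hk)
  obtain ⟨c₁, hc₁, C₁, hC₁, hlow⟩ := le_norm_weierstrassSigma_add_latt L hKc hKΛ
  set c₀ := min c₁ 1 with hc₀def
  have hc₀ : 0 < c₀ := by positivity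
  have hc₀1 : c₀ ≤ 1 := min_le_right _ _
  have hlog : 0 ≤ Real.log c₀⁻¹ := Real.log_nonneg (one_le_inv₀ hc₀ |>.mpr hc₀1)
  have hlogδ : 0 ≤ Real.log δ⁻¹ := Real.log_nonneg (one_le_inv₀ hδ |>.mpr hδ1)
  refine ⟨CA * Chudnovsky.r₀ L ^ 2 + 3 * (Real.log c₀⁻¹ + C₁) + Real.log δ⁻¹, by positivity,
    fun D L₁ X T hX p hF n₁ n₂ hn₁ hn₂ j => ?_⟩
  have hX' : (1 : ℝ) ≤ X := by exact_mod_cast hX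
  set z₀ := L.ω₁ / 2 + latt L n₁ n₂ with hz₀
  set A : ℝ := ‖p‖ * Real.exp (CA * (D + L₁ + 1) * (Chudnovsky.r₀ L * X) ^ 2) * Real.exp (-(T * X ^ 2 : ℝ)) with hAdef
  have hA0 : 0 ≤ A := by positivity
  set B : ℝ := A * Real.exp (3 * (Real.log c₀⁻¹ + C₁) * (D + 1) * (X : ℝ) ^ 2) with hBdef
  have hsphere : ∀ w ∈ sphere z₀ δ, ‖affF L c D L₁ p w‖ ≤ B := by
    intro w hw
    have hk : w - latt L n₁ n₂ ∈ sphere (L.ω₁ / 2) δ := by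
      rw [mem_sphere_iff_norm] at hw ⊢
      rw [← hw]; congr 1; rw [hz₀]; ring
    have hwΛ : w ∉ L.lattice := by
      intro h
      exact hKΛ _ hk (by simpa using L.lattice.sub_mem h (latt_mem_lattice L n₁ n₂))
    have hσ : c₀ * Real.exp (-(C₁ * (X : ℝ) ^ 2)) ≤ ‖L.weierstrassSigma w‖ := by
      have := hlow _ hk n₁ n₂ X hn₁.le hn₂.le
      rw [sub_add_cancel] at this
      refine le_trans ?_ this
      gcongr
      exact min_le_left _ _
    have hwn : ‖w‖ ≤ Chudnovsky.r₀ L * X := by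
      have := norm_halfPeriod_add_latt_le L hX hn₁ hn₂ (u := w - z₀)
        (by rw [mem_sphere_iff_norm] at hw; rw [hw]; exact hδ1)
      rwa [hz₀, add_sub_cancel] at this
    have hG : ‖auxF L c D L₁ p w‖ ≤ A := hA D L₁ X T hX p hF (Chudnovsky.r₀ L * X) le_rfl w hwn
    exact norm_affF_le_of_sigma_lower L c p hwΛ hG hA0 hc₀ hc₀1 hC₁ hX' hσ
  have hdiff : DiffContOnCl ℂ (affF L c D L₁ p) (ball z₀ δ) := by
    refine DifferentiableOn.diffContOnCl fun w hw => ?_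
    have hw' : w ∈ closedBall z₀ δ := closure_ball_subset_closedBall hw
    have hk : w - latt L n₁ n₂ ∈ closedBall (L.ω₁ / 2) δ := by
      rw [mem_closedBall_iff_norm] at hw' ⊢
      refine le_trans (le_of_eq ?_) hw'
      congr 1; rw [hz₀]; ring
    have hwΛ : w ∉ L.lattice := by
      intro h
      exact hball hk (by simpa using L.lattice.sub_mem h (latt_mem_lattice L n₁ n₂))
    exact (analyticAt_affF L c p hwΛ).differentiableAt.differentiableWithinAt
  have hC := Complex.norm_iteratedDeriv_le_of_forall_mem_sphere_norm_le j hδ hdiff hsphere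
  have hB : B ≤ ‖p‖ * Real.exp ((CA * Chudnovsky.r₀ L ^ 2 + 3 * (Real.log c₀⁻¹ + C₁)) * ((D + L₁ + 1) * X ^ 2)) *
      Real.exp (-(T * X ^ 2 : ℝ)) := by
    rw [hBdef, hAdef, mul_assoc ‖p‖, mul_assoc ‖p‖, Chudnovsky.exp_mul_exp_neg_mul_exp, ← mul_assoc]
    gcongr ‖p‖ * Real.exp ?_ * _
    have hL : (0 : ℝ) ≤ L₁ := Nat.cast_nonneg L₁
    have h1 : 3 * (Real.log c₀⁻¹ + C₁) * (D + 1) * (X : ℝ) ^ 2 ≤ 3 * (Real.log c₀⁻¹ + C₁) * ((D + L₁ + 1) * X ^ 2) := by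
      have : (0 : ℝ) ≤ 3 * (Real.log c₀⁻¹ + C₁) * X ^ 2 := by positivity
      nlinarith
    nlinarith
  have hδj : (δ ^ j)⁻¹ ≤ Real.exp (Real.log δ⁻¹ * j) := by
    rw [mul_comm, Real.exp_nat_mul, Real.exp_log (inv_pos.mpr hδ), inv_pow]
  set Ctot := CA * Chudnovsky.r₀ L ^ 2 + 3 * (Real.log c₀⁻¹ + C₁) + Real.log δ⁻¹ with hCtot
  calc ‖iteratedDeriv j (affF L c D L₁ p) z₀‖ ≤ j.factorial * B / δ ^ j := hC
    _ = j.factorial * B * (δ ^ j)⁻¹ := by rw [div_eq_mul_inv]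
    _ ≤ j.factorial * (‖p‖ * Real.exp ((CA * Chudnovsky.r₀ L ^ 2 + 3 * (Real.log c₀⁻¹ + C₁)) *
        ((D + L₁ + 1) * X ^ 2)) * Real.exp (-(T * X ^ 2 : ℝ))) * Real.exp (Real.log δ⁻¹ * j) := by gcongr
    _ = ‖p‖ * j.factorial * Real.exp ((CA * Chudnovsky.r₀ L ^ 2 + 3 * (Real.log c₀⁻¹ + C₁)) *
        ((D + L₁ + 1) * X ^ 2) + Real.log δ⁻¹ * j) * Real.exp (-(T * X ^ 2 : ℝ)) := by
        rw [Real.exp_add]; ring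
    _ ≤ ‖p‖ * j.factorial * Real.exp (Ctot * ((D + L₁ + 1) * X ^ 2 + j)) * Real.exp (-(T * X ^ 2 : ℝ)) := by
        gcongr
        rw [hCtot]
        have h1 : (0 : ℝ) ≤ (D + L₁ + 1) * X ^ 2 := by positivity
        have h2 : (0 : ℝ) ≤ j := by positivity
        have h3 : 0 ≤ CA * Chudnovsky.r₀ L ^ 2 + 3 * (Real.log c₀⁻¹ + C₁) := by positivity
        nlinarith [mul_nonneg hlogδ h1, mul_nonneg h3 h2]

end Tubbs

end Literature.NumberTheory.Transcendental
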